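import Mathlib

/-!
# TASK T-S5/U5 step (1b), brick T-S5.4r: the SECOND-ORDER EXPANSION of `log |det (1 + X)|` (`LogDetSecondOrder`), PROVED

Planner ym-idea-2 g17 (2026-08-29T17:46:27Z, re-confirmed in the 17:51:50Z sign-off): the GHOST-LOOP bookkeeping lemma of the T-S5.4
assembly — `log |det F(U)| − log |det F(1)| = tr(F₁⁻¹E) − ½ tr((F₁⁻¹E)²) + O(n ρ³)` with `X := F₁⁻¹E` (✓`fpOperator`, ✓4c-E).  Typed verbatim:

`LogDetSecondOrder : ∀ n (X : Matrix (Fin n) (Fin n) ℝ) ρ, 0 ≤ ρ → ρ ≤ 1/2 → (∀ v, Xv ⬝ᵥ Xv ≤ ρ²·(v ⬝ᵥ v)) →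
  det (1 + X) ≠ 0 ∧ |log |det (1 + X)| − tr X + tr (X·X)/2| ≤ 2 n ρ³`.

Proof (Mathlib only, no matrix logarithm).  Complexify, `Y = X.map ofReal`; over `ℂ` the characteristic polynomial splits with `n` roots `λᵢ`
(✓`Matrix.charpoly`, `IsAlgClosed.splits`).  (1) `det (1 + Y) = ∏ (1 + λᵢ)` (✓`Matrix.eval_charpoly` at `−1`); (2) `tr Y = Σ λᵢ`
(✓`Matrix.trace_eq_sum_roots_charpoly`); (3) `tr Y² = Σ λᵢ²` — Vieta for `e₂` (✓`Polynomial.coeff_eq_esymm_roots_of_card`), the principal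
`2 × 2` minors (✓`Matrix.charpoly_coeff_eq_sum_minors`, `two_mul_sum_minors_two`: `2Σ_{|s|=2} det Y_s = (tr Y)² − tr Y²`) and Newton's identity
`Σλ² = (Σλ)² − 2e₂` (`multiset_sum_sq_eq`); (4) every root has `‖λᵢ‖ ≤ ρ` (an eigenvector `u + iv` and the REAL operator bound:
`‖Yw‖² = ‖Xu‖² + ‖Xv‖²`); (5) `log |∏(1+λᵢ)| = Σ Re log (1 + λᵢ)` and the complex Taylor bound ✓`Complex.norm_log_sub_logTaylor_le`:
`‖log (1+z) − z + z²/2‖ ≤ ‖z‖³/(3(1−‖z‖)) ≤ 2ρ³`.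

HONEST LABEL: one elementary brick (matrix analysis) of step (1b) of the XL stubs S5/U5; T-S5.4 proper, S5, U5, ⟨24004⟩ ⟨24335⟩ ⟨24336⟩ remain
OPEN; no crux, rung or summit is proved; the Yang–Mills mass gap is NOT proved by this file.  Seat ym-line-sfw-p2-w2 g30 (cell ym-idea-1).
-/

set_option autoImplicit false

noncomputable section

open Matrix Finset Polynomial

namespace Summit.QuantumFields.YangMills.Theorems.AllWindowsColdBoxBoxHighLine

namespace LogDet


/-! ## Sums over 2-subsets -/

/-- Double counting: twice the sum of `g` over the 2-subsets of `S` is the sum of `g {i, j}` over ordered pairs of distinct elements. -/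
theorem two_mul_sum_powersetCard_two {ι : Type*} [DecidableEq ι] {R : Type*} [CommRing R] (S : Finset ι) (g : Finset ι → R) :
    2 * ∑ s ∈ S.powersetCard 2, g s = ∑ i ∈ S, ∑ j ∈ S.erase i, g {i, j} := by
  induction S using Finset.induction_on with
  | empty => rw [Finset.powersetCard_eq_empty.2 (by simp)]; simp
  | insert a S ha ih =>
    have hdisj : Disjoint (S.powersetCard 2) ((S.powersetCard 1).image (insert a)) :=
      Finset.disjoint_left.2 fun s hs hs' => by
        rw [Finset.mem_image] at hs'
        obtain ⟨t, _, rfl⟩ := hs'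
        exact ha ((Finset.mem_powersetCard.1 hs).1 (Finset.mem_insert_self a t))
    have hinj : Set.InjOn (insert a) ((S.powersetCard 1 : Finset (Finset ι)) : Set (Finset ι)) := by
      intro s hs t ht hst
      have has : a ∉ s := fun h => ha ((Finset.mem_powersetCard.1 hs).1 h)
      have hat : a ∉ t := fun h => ha ((Finset.mem_powersetCard.1 ht).1 h)
      rw [← Finset.erase_insert has, hst, Finset.erase_insert hat]
    rw [Finset.powersetCard_succ_insert ha, Finset.sum_union hdisj, Finset.sum_image hinj, Finset.powersetCard_one, Finset.sum_map,
      mul_add, ih, Finset.sum_insert ha, Finset.erase_insert ha]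
    have h1 : ∑ i ∈ S, ∑ j ∈ (insert a S).erase i, g {i, j} = ∑ i ∈ S, (g {a, i} + ∑ j ∈ S.erase i, g {i, j}) := by
      refine Finset.sum_congr rfl fun i hi => ?_
      have hai : a ≠ i := fun h => ha (h ▸ hi)
      rw [Finset.erase_insert_of_ne hai, Finset.sum_insert (fun h => ha (Finset.mem_of_mem_erase h)), Finset.pair_comm]
    rw [h1, Finset.sum_add_distrib]
    have h3 : ∑ x ∈ S, g (insert a ((⟨_, Finset.singleton_injective⟩ : ι ↪ Finset ι) x)) = ∑ j ∈ S, g {a, j} :=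
      Finset.sum_congr rfl fun j _ => rfl
    rw [h3]
    ring

/-! ## Principal `2 × 2` minors -/

/-- The principal minor of a pair `{i, j}`, `i ≠ j`. -/
theorem det_submatrix_pair {ι : Type*} [DecidableEq ι] (Y : Matrix ι ι ℂ) {i j : ι} (hij : i ≠ j) :
    (Y.submatrix (Subtype.val : ↥({i, j} : Finset ι) → ι) (Subtype.val : ↥({i, j} : Finset ι) → ι)).det =
      Y i i * Y j j - Y i j * Y j i := by
  let a : ↥({i, j} : Finset ι) := ⟨i, by simp⟩
  let b : ↥({i, j} : Finset ι) := ⟨j, by simp⟩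
  have hab : a ≠ b := fun h => hij (congrArg Subtype.val h)
  have hall : ∀ z : ↥({i, j} : Finset ι), z = a ∨ z = b := fun z => by
    rcases Finset.mem_insert.1 z.2 with h | h
    · exact Or.inl (Subtype.ext h)
    · exact Or.inr (Subtype.ext (Finset.mem_singleton.1 h))
  let e : Fin 2 → ↥({i, j} : Finset ι) := ![a, b]
  have he : Function.Bijective e := by
    constructor
    · intro x y hxy
      fin_cases x <;> fin_cases y
      · rfl
      · exact absurd hxy hab
      · exact absurd hxy.symm hab
      · rfl
    · intro z
      rcases hall z with h | h
      · exact ⟨0, h.symm⟩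
      · exact ⟨1, h.symm⟩
  rw [← Matrix.det_submatrix_equiv_self (Equiv.ofBijective e he), Matrix.det_fin_two]
  simp [e, a, b, Matrix.submatrix_apply]

/-- **`2 · Σ_{|s|=2} det(Y_s) = (tr Y)² − tr(Y²)`** (principal `2 × 2` minors). -/
theorem two_mul_sum_minors_two {ι : Type*} [DecidableEq ι] [Fintype ι] (Y : Matrix ι ι ℂ) :
    2 * ∑ s ∈ (Finset.univ : Finset ι).powersetCard 2, (Y.submatrix (Subtype.val : ↥s → ι) (Subtype.val : ↥s → ι)).det =
      Y.trace ^ 2 - (Y * Y).trace := by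
  rw [two_mul_sum_powersetCard_two Finset.univ fun s : Finset ι => (Y.submatrix (Subtype.val : ↥s → ι) (Subtype.val : ↥s → ι)).det]
  have hpair : ∑ i, ∑ j ∈ Finset.univ.erase i,
      (Y.submatrix (Subtype.val : ↥({i, j} : Finset ι) → ι) (Subtype.val : ↥({i, j} : Finset ι) → ι)).det =
      ∑ i, ∑ j ∈ Finset.univ.erase i, (Y i i * Y j j - Y i j * Y j i) :=
    Finset.sum_congr rfl fun i _ => Finset.sum_congr rfl fun j hj => det_submatrix_pair Y (Finset.ne_of_mem_erase hj).symm
  rw [hpair]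
  have hsq : Y.trace ^ 2 = ∑ i, ∑ j, Y i i * Y j j := by rw [Matrix.trace, sq, Finset.sum_mul_sum]; rfl
  have htr : (Y * Y).trace = ∑ i, ∑ j, Y i j * Y j i := by simp [Matrix.trace, Matrix.mul_apply]
  rw [hsq, htr, ← Finset.sum_sub_distrib]
  refine Finset.sum_congr rfl fun i _ => ?_
  rw [← Finset.sum_sub_distrib, ← Finset.add_sum_erase _ _ (Finset.mem_univ i)]
  ring



/-! ## Newton at order two for multisets -/

/-- `esymm 1 = sum`. -/
theorem esymm_one_eq_sum (s : Multiset ℂ) : s.esymm 1 = s.sum := by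
  simp [Multiset.esymm, Multiset.powersetCard_one, Multiset.map_map]

/-- `esymm 2 (a ::ₘ s) = esymm 2 s + a * s.sum`. -/
theorem esymm_two_cons (a : ℂ) (s : Multiset ℂ) : (a ::ₘ s).esymm 2 = s.esymm 2 + a * s.sum := by
  rw [Multiset.esymm, Multiset.powersetCard_cons, Multiset.map_add, Multiset.sum_add]
  congr 1
  rw [← esymm_one_eq_sum s, Multiset.esymm, Multiset.map_map, ← Multiset.sum_map_mul_left]
  refine congrArg Multiset.sum (Multiset.map_congr rfl fun t _ => ?_)
  simp

/-- **Newton's identity at order two** for a multiset: `Σ z² = (Σ z)² − 2 e₂`. -/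
theorem multiset_sum_sq_eq (s : Multiset ℂ) : (s.map fun z => z ^ 2).sum = s.sum ^ 2 - 2 * s.esymm 2 := by
  induction s using Multiset.induction_on with
  | empty => simp [Multiset.esymm, Multiset.powersetCard_eq_empty]
  | cons a s ih => rw [Multiset.map_cons, Multiset.sum_cons, Multiset.sum_cons, esymm_two_cons, ih]; ring

/-! ## Logarithm of a product over a multiset -/

/-- `log ∏ = Σ log` for a multiset of nonzero reals. -/
theorem log_multiset_prod (s : Multiset ℝ) (hs : ∀ x ∈ s, x ≠ 0) : Real.log s.prod = (s.map Real.log).sum := by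
  induction s using Multiset.induction_on with
  | empty => simp
  | cons a s ih =>
    have ha : a ≠ 0 := hs a (Multiset.mem_cons_self a s)
    have hs' : ∀ x ∈ s, x ≠ 0 := fun x hx => hs x (Multiset.mem_cons_of_mem hx)
    have hprod : s.prod ≠ 0 := Multiset.prod_ne_zero fun h => hs' 0 h rfl
    rw [Multiset.prod_cons, Multiset.map_cons, Multiset.sum_cons, Real.log_mul ha hprod, ih hs']

/-! ## Eigenvalues of a real matrix with an ℓ² operator bound -/

variable {n : ℕ}

/-- Real and imaginary parts of `Y v` for the complexification `Y` of a real matrix. -/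
theorem mulVec_map_ofReal_re (X : Matrix (Fin n) (Fin n) ℝ) (v : Fin n → ℂ) (k : Fin n) :
    ((X.map ((↑) : ℝ → ℂ)) *ᵥ v) k = ((X *ᵥ fun j => (v j).re) k : ℝ) + ((X *ᵥ fun j => (v j).im) k : ℝ) * Complex.I := by
  simp only [Matrix.mulVec, dotProduct, Matrix.map_apply]
  apply Complex.ext
  · simp [Complex.re_sum]
  · simp [Complex.im_sum]

/-- Every root of the characteristic polynomial of the complexified matrix (every complex eigenvalue) is bounded by the ℓ² operator bound
of the real matrix. -/
theorem norm_le_of_mem_roots_charpoly (X : Matrix (Fin n) (Fin n) ℝ) {ρ : ℝ} (hρ : 0 ≤ ρ)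
    (hX : ∀ v : Fin n → ℝ, X.mulVec v ⬝ᵥ X.mulVec v ≤ ρ ^ 2 * (v ⬝ᵥ v)) {μ : ℂ}
    (hμ : μ ∈ (X.map ((↑) : ℝ → ℂ)).charpoly.roots) : ‖μ‖ ≤ ρ := by
  set Y : Matrix (Fin n) (Fin n) ℂ := X.map ((↑) : ℝ → ℂ) with hY
  have hroot : (Matrix.scalar (Fin n) μ - Y).det = 0 := by
    have h := (Polynomial.mem_roots (Matrix.charpoly_monic Y).ne_zero).1 hμ
    rwa [Polynomial.IsRoot.def, Matrix.eval_charpoly] at h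
  obtain ⟨v, hv0, hv⟩ := Matrix.exists_mulVec_eq_zero_iff.2 hroot
  have hYv : ∀ k, (Y *ᵥ v) k = μ * v k := by
    intro k
    have := congrFun hv k
    rw [Matrix.sub_mulVec, Pi.sub_apply, Pi.zero_apply, sub_eq_zero, Matrix.scalar_apply, Matrix.mulVec_diagonal] at this
    exact this.symm
  -- real and imaginary parts
  set u : Fin n → ℝ := fun j => (v j).re with hu
  set w : Fin n → ℝ := fun j => (v j).im with hw
  have hnormYv : ∀ k, ‖(Y *ᵥ v) k‖ ^ 2 = (X *ᵥ u) k ^ 2 + (X *ᵥ w) k ^ 2 := by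
    intro k
    rw [hY, mulVec_map_ofReal_re, Complex.sq_norm, Complex.normSq_apply]
    simp
    ring
  have hnormv : ∀ k, ‖v k‖ ^ 2 = u k ^ 2 + w k ^ 2 := by
    intro k; rw [Complex.sq_norm, Complex.normSq_apply]; simp [hu, hw]; ring
  have hS : ∑ k, ‖(Y *ᵥ v) k‖ ^ 2 = ‖μ‖ ^ 2 * ∑ k, ‖v k‖ ^ 2 := by
    rw [Finset.mul_sum]
    exact Finset.sum_congr rfl fun k _ => by rw [hYv, norm_mul, mul_pow]
  have hT : ∑ k, ‖(Y *ᵥ v) k‖ ^ 2 ≤ ρ ^ 2 * ∑ k, ‖v k‖ ^ 2 := by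
    simp only [hnormYv, hnormv, Finset.sum_add_distrib, mul_add]
    have h1 := hX u
    have h2 := hX w
    simp only [dotProduct, ← sq] at h1 h2
    exact add_le_add h1 h2
  have hpos : 0 < ∑ k, ‖v k‖ ^ 2 := by
    obtain ⟨k, hk⟩ : ∃ k, v k ≠ 0 := by
      by_contra h
      push Not at h
      exact hv0 (funext h)
    exact lt_of_lt_of_le (by positivity : 0 < ‖v k‖ ^ 2)
      (Finset.single_le_sum (f := fun k => ‖v k‖ ^ 2) (fun _ _ => sq_nonneg _) (Finset.mem_univ k))
  have hμ2 : ‖μ‖ ^ 2 ≤ ρ ^ 2 := le_of_mul_le_mul_right (by linarith [hS.symm.le.trans hT]) hpos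
  exact (sq_le_sq₀ (norm_nonneg _) hρ).1 hμ2

/-- `det (1 + X) ≠ 0` when the ℓ² operator bound `ρ ∈ [0, 1)`. -/
theorem det_one_add_ne_zero (X : Matrix (Fin n) (Fin n) ℝ) {ρ : ℝ} (hρ0 : 0 ≤ ρ) (hρ1 : ρ < 1)
    (hX : ∀ v : Fin n → ℝ, X.mulVec v ⬝ᵥ X.mulVec v ≤ ρ ^ 2 * (v ⬝ᵥ v)) : (1 + X).det ≠ 0 := by
  intro h
  obtain ⟨v, hv0, hv⟩ := Matrix.exists_mulVec_eq_zero_iff.2 h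
  rw [Matrix.add_mulVec, Matrix.one_mulVec, add_eq_zero_iff_eq_neg] at hv
  have hvv : v ⬝ᵥ v = (X *ᵥ v) ⬝ᵥ (X *ᵥ v) := by
    conv_lhs => rw [hv]
    simp [dotProduct]
  have h1 := hX v
  have hpos : 0 < v ⬝ᵥ v := by
    obtain ⟨k, hk⟩ : ∃ k, v k ≠ 0 := by
      by_contra h'
      push Not at h'
      exact hv0 (funext h')
    exact lt_of_lt_of_le (mul_self_pos.2 hk) (Finset.single_le_sum (f := fun i => v i * v i) (fun _ _ => mul_self_nonneg _) (Finset.mem_univ k))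
  have hρ2 : ρ ^ 2 < 1 := by nlinarith
  nlinarith [hvv, h1, hpos]




/-- `det (1 + Y) = ↑(det (1 + X))`. -/
theorem det_one_add_map (X : Matrix (Fin n) (Fin n) ℝ) : (1 + X.map ((↑) : ℝ → ℂ)).det = (((1 + X).det : ℝ) : ℂ) := by
  have h := RingHom.map_det Complex.ofRealHom (1 + X)
  rw [map_add, map_one] at h
  exact h.symm

/-- `tr Y = ↑(tr X)`. -/
theorem trace_map (X : Matrix (Fin n) (Fin n) ℝ) : (X.map ((↑) : ℝ → ℂ)).trace = ((X.trace : ℝ) : ℂ) := by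
  simp [Matrix.trace, Matrix.map_apply, Complex.ofReal_sum]

/-- `tr Y² = ↑(tr X²)`. -/
theorem trace_map_sq (X : Matrix (Fin n) (Fin n) ℝ) :
    (X.map ((↑) : ℝ → ℂ) * X.map ((↑) : ℝ → ℂ)).trace = (((X * X).trace : ℝ) : ℂ) := by
  rw [← trace_map (X * X)]
  show (Complex.ofRealHom.mapMatrix X * Complex.ofRealHom.mapMatrix X).trace = (Complex.ofRealHom.mapMatrix (X * X)).trace
  rw [← map_mul]

/-- The roots of the characteristic polynomial of the complexification: there are `n` of them. -/
theorem card_roots_charpoly (Y : Matrix (Fin n) (Fin n) ℂ) : Multiset.card Y.charpoly.roots = n := by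
  rw [Polynomial.splits_iff_card_roots.1 (IsAlgClosed.splits Y.charpoly), Matrix.charpoly_natDegree_eq_dim, Fintype.card_fin]

/-- `det (1 + Y) = ∏ (1 + λᵢ)` over the roots of the characteristic polynomial. -/
theorem det_one_add_eq_prod_roots (Y : Matrix (Fin n) (Fin n) ℂ) :
    (1 + Y).det = (Y.charpoly.roots.map fun z => 1 + z).prod := by
  have hcard : Multiset.card Y.charpoly.roots = Y.charpoly.natDegree := by
    rw [card_roots_charpoly, Matrix.charpoly_natDegree_eq_dim, Fintype.card_fin]
  have hprod := Polynomial.prod_multiset_X_sub_C_of_monic_of_roots_card_eq (Matrix.charpoly_monic Y) hcard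
  have heval := Matrix.eval_charpoly Y (-1)
  rw [← hprod, Polynomial.eval_multiset_prod, Multiset.map_map] at heval
  have h1 : Matrix.scalar (Fin n) (-1 : ℂ) - Y = -(1 + Y) := by
    rw [map_neg, map_one]; abel
  rw [h1, Matrix.det_neg, Fintype.card_fin] at heval
  have h2 : (Y.charpoly.roots.map ((fun p => Polynomial.eval (-1) p) ∘ fun a => X - C a)).prod =
      (-1) ^ n * (Y.charpoly.roots.map fun z => 1 + z).prod := by
    have : ((fun p => Polynomial.eval (-1) p) ∘ fun a => X - C a) = Neg.neg ∘ fun z : ℂ => 1 + z := by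
      funext z; simp; ring
    rw [this, ← Multiset.map_map, Multiset.prod_map_neg, Multiset.card_map, card_roots_charpoly]
  rw [h2] at heval
  have hu : ((-1 : ℂ) ^ n) ≠ 0 := pow_ne_zero _ (by norm_num)
  exact mul_left_cancel₀ hu heval.symm

/-- `tr (Y²) = Σ λᵢ²` over the roots of the characteristic polynomial (Vieta for `e₂` + the principal `2 × 2` minors + Newton). -/
theorem trace_sq_eq_sum_roots_sq (Y : Matrix (Fin n) (Fin n) ℂ) :
    (Y * Y).trace = (Y.charpoly.roots.map fun z => z ^ 2).sum := by
  have he2 : Y.charpoly.roots.esymm 2 =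
      ∑ s ∈ (Finset.univ : Finset (Fin n)).powersetCard 2, (Y.submatrix (Subtype.val : ↥s → Fin n) (Subtype.val : ↥s → Fin n)).det := by
    by_cases hn : 2 ≤ n
    · have hcard : Multiset.card Y.charpoly.roots = Y.charpoly.natDegree := by
        rw [card_roots_charpoly, Matrix.charpoly_natDegree_eq_dim, Fintype.card_fin]
      have hdeg : Y.charpoly.natDegree = n := by rw [Matrix.charpoly_natDegree_eq_dim, Fintype.card_fin]
      have hV := Polynomial.coeff_eq_esymm_roots_of_card hcard (k := n - 2) (by omega)
      rw [(Matrix.charpoly_monic Y).leadingCoeff, one_mul, hdeg, show n - (n - 2) = 2 by omega] at hV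
      have hM := Matrix.charpoly_coeff_eq_sum_minors Y 2 (by rw [Fintype.card_fin]; exact hn)
      rw [Fintype.card_fin] at hM
      rw [hM] at hV
      norm_num at hV
      exact hV.symm
    · push Not at hn
      have h1 : Y.charpoly.roots.esymm 2 = 0 := by
        rw [Multiset.esymm, Multiset.powersetCard_eq_empty 2 (by rw [card_roots_charpoly]; exact hn)]; simp
      have h2 : (Finset.univ : Finset (Fin n)).powersetCard 2 = ∅ :=
        Finset.powersetCard_eq_empty.2 (by rw [Finset.card_univ, Fintype.card_fin]; exact hn)
      rw [h1, h2, Finset.sum_empty]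
  have hN := multiset_sum_sq_eq Y.charpoly.roots
  have hm := two_mul_sum_minors_two Y
  rw [← he2] at hm
  rw [hN, ← Matrix.trace_eq_sum_roots_charpoly]
  linear_combination hm


/-! ## The Taylor remainder of `log (1 + z)` at order three -/

/-- `logTaylor 3 z = z − z²/2`. -/
theorem logTaylor_three (z : ℂ) : Complex.logTaylor 3 z = z - z ^ 2 / 2 := by
  simp [Complex.logTaylor, Finset.sum_range_succ]
  ring

/-- `‖log (1 + z) − z + z²/2‖ ≤ 2ρ³` for `‖z‖ ≤ ρ ≤ 1/2`. -/
theorem norm_log_sub_le {z : ℂ} {ρ : ℝ} (hz : ‖z‖ ≤ ρ) (hρ : ρ ≤ 1 / 2) :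
    ‖Complex.log (1 + z) - z + z ^ 2 / 2‖ ≤ 2 * ρ ^ 3 := by
  have hz1 : ‖z‖ < 1 := by linarith
  have h := Complex.norm_log_sub_logTaylor_le 2 hz1
  rw [logTaylor_three] at h
  have hrw : Complex.log (1 + z) - z + z ^ 2 / 2 = Complex.log (1 + z) - (z - z ^ 2 / 2) := by ring
  rw [hrw]
  refine h.trans ?_
  have h0 : 0 ≤ ‖z‖ := norm_nonneg z
  have h3 : ‖z‖ ^ (2 + 1) ≤ ρ ^ 3 := by simpa using pow_le_pow_left₀ h0 hz 3
  have hinv : (1 - ‖z‖)⁻¹ ≤ 2 := by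
    rw [inv_le_comm₀ (by linarith) (by norm_num)]; linarith
  have hρ0 : 0 ≤ ρ := h0.trans hz
  calc ‖z‖ ^ (2 + 1) * (1 - ‖z‖)⁻¹ / (2 + 1) ≤ ρ ^ 3 * 2 / (2 + 1) := by
        gcongr
    _ ≤ 2 * ρ ^ 3 := by nlinarith [pow_nonneg hρ0 3]

end LogDet

/-! ## The task's Prop (verbatim from planner ym-idea-2 g17, 2026-08-29T17:46:27Z) and its proof -/

/-- T-S5.4r **(second-order expansion of `log |det (1 + X)|`; M)**: for a real `n × n` matrix with ℓ²-operator bound `ρ ≤ 1/2`,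
`det (1 + X) ≠ 0` and `|log |det (1 + X)| − tr X + tr (X²)/2| ≤ 2 n ρ³`. -/
def LogDetSecondOrder : Prop := ∀ (n : ℕ) (X : Matrix (Fin n) (Fin n) ℝ) (ρ : ℝ), 0 ≤ ρ → ρ ≤ 1 / 2 →
  (∀ v : Fin n → ℝ, X.mulVec v ⬝ᵥ X.mulVec v ≤ ρ ^ 2 * (v ⬝ᵥ v)) →
  (1 + X).det ≠ 0 ∧ |Real.log |(1 + X).det| - X.trace + (X * X).trace / 2| ≤ 2 * n * ρ ^ 3

open LogDet in
/-- **T-S5.4r: the second-order expansion of `log |det (1 + X)|` (the ghost loop).** -/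
theorem logDetSecondOrder : LogDetSecondOrder := by
  intro n X ρ h0 h12 hX
  have hdet : (1 + X).det ≠ 0 := det_one_add_ne_zero X h0 (by linarith) hX
  refine ⟨hdet, ?_⟩
  set Y : Matrix (Fin n) (Fin n) ℂ := X.map ((↑) : ℝ → ℂ) with hY
  set μ : Multiset ℂ := Y.charpoly.roots with hμ
  have hcard : Multiset.card μ = n := card_roots_charpoly Y
  have hbound : ∀ z ∈ μ, ‖z‖ ≤ ρ := fun z hz => norm_le_of_mem_roots_charpoly X h0 hX hz
  have hne : ∀ z ∈ μ, 1 + z ≠ 0 := by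
    intro z hz h
    have : ‖z‖ = 1 := by rw [← norm_neg, show -z = 1 from by linear_combination -h, norm_one]
    linarith [hbound z hz]
  -- the three spectral identities
  have hD : (((1 + X).det : ℝ) : ℂ) = (μ.map fun z => 1 + z).prod := by rw [← det_one_add_map, det_one_add_eq_prod_roots]
  have hT1 : ((X.trace : ℝ) : ℂ) = μ.sum := by rw [← trace_map, Matrix.trace_eq_sum_roots_charpoly]
  have hT2 : (((X * X).trace : ℝ) : ℂ) = (μ.map fun z => z ^ 2).sum := by rw [← trace_map_sq, trace_sq_eq_sum_roots_sq]
  -- `log |det (1 + X)| = Σ Re log (1 + λᵢ)`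
  have hlog : Real.log |(1 + X).det| = (μ.map fun z => (Complex.log (1 + z)).re).sum := by
    have h1 : |(1 + X).det| = ‖(((1 + X).det : ℝ) : ℂ)‖ := by rw [Complex.norm_real, Real.norm_eq_abs]
    rw [h1, hD]
    have h2 : ‖(μ.map fun z => 1 + z).prod‖ = ((μ.map fun z => 1 + z).map fun w => ‖w‖).prod := by
      have := map_multiset_prod (normHom : ℂ →*₀ ℝ) (μ.map fun z => 1 + z)
      simpa using this
    rw [h2, log_multiset_prod, Multiset.map_map, Multiset.map_map]
    · refine congrArg Multiset.sum (Multiset.map_congr rfl fun z _ => ?_)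
      simp [Complex.log_re]
    · intro x hx
      rw [Multiset.mem_map] at hx
      obtain ⟨w, hw, rfl⟩ := hx
      rw [Multiset.mem_map] at hw
      obtain ⟨z, hz, rfl⟩ := hw
      exact norm_ne_zero_iff.2 (hne z hz)
  -- the target as the real part of `Σ (log (1 + λ) − λ + λ²/2)`
  set F : ℂ → ℂ := fun z => Complex.log (1 + z) - z + z ^ 2 / 2 with hF
  have hkey : Real.log |(1 + X).det| - X.trace + (X * X).trace / 2 = ((μ.map F).sum).re := by
    have hsum : (μ.map F).sum = (μ.map fun z => Complex.log (1 + z)).sum - μ.sum + (μ.map fun z => z ^ 2).sum * 2⁻¹ := by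
      simp only [hF, Multiset.sum_map_add, Multiset.sum_map_sub, Multiset.map_id', div_eq_mul_inv, Multiset.sum_map_mul_right]
    have hre : ((μ.map fun z => Complex.log (1 + z)).sum).re = (μ.map fun z => (Complex.log (1 + z)).re).sum := by
      have := map_multiset_sum Complex.reLm (μ.map fun z => Complex.log (1 + z))
      rw [Complex.reLm_coe, Multiset.map_map] at this
      exact this
    have h2 : ((μ.map fun z => z ^ 2).sum * 2⁻¹).re = (X * X).trace / 2 := by
      rw [← hT2, show (((X * X).trace : ℝ) : ℂ) * 2⁻¹ = (((X * X).trace / 2 : ℝ) : ℂ) by push_cast; ring, Complex.ofReal_re]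
    rw [hsum, Complex.add_re, Complex.sub_re, h2, hre, ← hlog, ← hT1, Complex.ofReal_re]
  rw [hkey]
  -- estimate
  calc |((μ.map F).sum).re| ≤ ‖(μ.map F).sum‖ := Complex.abs_re_le_norm _
    _ ≤ ((μ.map F).map fun w => ‖w‖).sum := norm_multiset_sum_le _
    _ ≤ Multiset.card ((μ.map F).map fun w => ‖w‖) • (2 * ρ ^ 3) := by
        refine Multiset.sum_le_card_nsmul _ _ fun x hx => ?_
        rw [Multiset.map_map, Multiset.mem_map] at hx
        obtain ⟨z, hz, rfl⟩ := hx
        exact norm_log_sub_le (hbound z hz) h12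
    _ = 2 * n * ρ ^ 3 := by rw [Multiset.card_map, Multiset.card_map, hcard, nsmul_eq_mul]; ring

end Summit.QuantumFields.YangMills.Theorems.AllWindowsColdBoxBoxHighLine

end
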